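import Literature.Probability.LatticeModels.BallPathFrame
import HarnessLib

/-!
# Random lattice paths from `x` to `y` inside the ball `B((x+y)/2, 2‖x−y‖)` in `ℤ^d`, `d ≥ 3`

Step 2 of the proof of Theorem 1.3 of Garban–Spencer (arXiv:2109.01617, p. 10: "one may travel
from any `x` to `y` using … directed cones … The (non-optimal) geometric condition
`B((x+y)/2, 2‖x−y‖₂) ⊂ Λ` is there only to ensure that the above cones remain inside `Λ`")
requires, for every pair `x ≠ y` of `ℤ^d`, a probability measure on simple nearest-neighbour
paths from `x` to `y` inside that ball with the exponential-intersection-tails property.  The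
source sketches a concatenation of four reflected cones of Benjamini–Pemantle–Peres paths; the
tree uses the following explicit single-leg construction driven by the randomness `PEnv T T` of
`UnpredictablePairTails` (two dyadic-velocity walks `S₀, S₁`):

* a **frame**: the axis `i₀` of largest displacement `|y_{i₀} − x_{i₀}| = T = ‖y − x‖_∞ ≥ 1`,
  its sign `σ`, and two further distinct axes `j₀, k₀` (this is where `d ≥ 3` enters);
* block `t = 0, …, T−1` moves first one step `σ e_{i₀}`, then adjusts every other coordinate
  `l` from `c_l(t)` to `c_l(t+1)`, where `c_l(t) = x_l + ⌊t (y_l − x_l)/T⌋ + [l = j₀] S₀(τ_t)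
  + [l = k₀] S₁(τ_t)` with the *reflected clock* `τ_t = min(t, T − t)` (so that the random part
  vanishes at both ends and the path ends exactly at `y`).

This file (continuing `BallPathFrame`, which has the frame, the clock and the drift): the skeleton
`c_l(t)` and its increments (`|Δ| ≤ 2`, `Δ_{i₀} = σ`), the phase lists and the vertex list
`verts`, and the facts: `verts` starts at `x` and ends at `y`, consecutive vertices are lattice
neighbours, the vertices are pairwise distinct, and every vertex lies in the closed ball
`B((x+y)/2, 2‖x−y‖₂)` (in the squared form of `GarbanSpencer2022_xyLongRangeOrder`).  The overlap
bound is in `BallPathOverlap`.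

## References

* C. Garban, T. Spencer, arXiv:2109.01617, proof of Theorem 1.3, Step 2 (p. 10).
  [GarbanSpencer2022]
-/

noncomputable section

open Finset
open scoped BigOperators

namespace Literature.Probability.LatticeModels

namespace BallPath

open Trail DyadicWalk

variable {d : ℕ}

namespace Frame

variable (F : Frame d)

/-! ### The skeleton `c_l(t)` -/

/-- The randomness of one path in this frame: two dyadic-velocity walks with `K = m = T`.
[folklore] -/
abbrev Rnd : Type := PEnv F.T F.T

/-- The random transverse part: `S₀(τ)` on the axis `j₀`, `S₁(τ)` on the axis `k₀`, `0` elsewhere.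
[folklore] -/
def rand (ω : F.Rnd) (l : Fin d) (τ : ℕ) : ℤ :=
  (if l = F.j₀ then S ω 0 τ else 0) + (if l = F.k₀ then S ω 1 τ else 0)

/-- The skeleton coordinate `c_l(t) = x_l + ⌊t v_l/T⌋ + rand_l(τ_t)`. [folklore] -/
def cpos (ω : F.Rnd) (l : Fin d) (t : ℕ) : ℤ := F.x l + F.drift l t + F.rand ω l (F.tau t)

/-- The skeleton point `P(t) = (c_l(t))_l`, start of block `t`. [folklore] -/
def P (ω : F.Rnd) (t : ℕ) : Site d := fun l => F.cpos ω l t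

/-- The increment `Δ_l(t) = c_l(t+1) − c_l(t)` of block `t`. [folklore] -/
def Δ (ω : F.Rnd) (l : Fin d) (t : ℕ) : ℤ := F.cpos ω l (t + 1) - F.cpos ω l t

/-- `rand` vanishes at clock `0`. [folklore] -/
@[simp] theorem rand_zero (ω : F.Rnd) (l : Fin d) : F.rand ω l 0 = 0 := by simp [rand, S]

/-- `rand` vanishes off the two random axes. [folklore] -/
theorem rand_of_ne (ω : F.Rnd) {l : Fin d} (hj : l ≠ F.j₀) (hk : l ≠ F.k₀) (τ : ℕ) :
    F.rand ω l τ = 0 := by simp [rand, hj, hk]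

/-- `0 ≤ rand ≤ τ/2`. [folklore] -/
theorem rand_nonneg (ω : F.Rnd) (l : Fin d) (τ : ℕ) : 0 ≤ F.rand ω l τ := by
  unfold rand; split_ifs <;> first | positivity | (have := ipos_nonneg (walk ω 0) τ; have := ipos_nonneg (walk ω 1) τ; unfold S; positivity)

/-- `rand ≤ τ/2` (as reals; the two random axes are distinct). [folklore] -/
theorem rand_le (ω : F.Rnd) (l : Fin d) (τ : ℕ) : (F.rand ω l τ : ℝ) ≤ τ / 2 := by
  unfold rand
  have h0 := ipos_le (walk ω 0) τ
  have h1 := ipos_le (walk ω 1) τ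
  have hτ : (0 : ℝ) ≤ τ / 2 := by positivity
  by_cases hj : l = F.j₀
  · have hk : l ≠ F.k₀ := fun h => F.hjk (hj.symm.trans h)
    rw [if_pos hj, if_neg hk, add_zero]
    exact h0
  · by_cases hk : l = F.k₀
    · rw [if_neg hj, if_pos hk, zero_add]; exact h1
    · rw [if_neg hj, if_neg hk, add_zero, Int.cast_zero]; exact hτ

/-- **`P(0) = x`.** [folklore] -/
@[simp] theorem P_zero (ω : F.Rnd) : F.P ω 0 = F.x := by
  funext l; simp [P, cpos]

/-- **`P(T) = y`.** [folklore] -/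
@[simp] theorem P_T (ω : F.Rnd) : F.P ω F.T = F.y := by
  funext l; simp [P, cpos, v]

/-- Along the time axis the skeleton is exact: `c_{i₀}(t) = x_{i₀} + σ t`. [folklore] -/
theorem cpos_i₀ (ω : F.Rnd) (t : ℕ) : F.cpos ω F.i₀ t = F.x F.i₀ + F.σ * t := by
  rw [cpos, drift_i₀, F.rand_of_ne ω F.hj.symm F.hk.symm, add_zero]

/-- `Δ_{i₀}(t) = σ`. [folklore] -/
theorem Δ_i₀ (ω : F.Rnd) (t : ℕ) : F.Δ ω F.i₀ t = F.σ := by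
  rw [Δ, cpos_i₀, cpos_i₀]; push_cast; ring

/-- The random part moves by at most one per block. [folklore] -/
theorem abs_rand_tau_succ_sub_le (ω : F.Rnd) (l : Fin d) (t : ℕ) :
    |F.rand ω l (F.tau (t + 1)) - F.rand ω l (F.tau t)| ≤ 1 := by
  have key : ∀ (a : Fin 2), |S ω a (F.tau (t + 1)) - S ω a (F.tau t)| ≤ 1 := by
    intro a
    rcases F.tau_succ t with h | h | h
    · rw [h, sub_self, abs_zero]; exact zero_le_one
    · rw [h]; exact abs_ipos_succ_sub_le _ _
    · rw [← h, abs_sub_comm]; exact abs_ipos_succ_sub_le _ _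
  unfold rand
  by_cases hj : l = F.j₀
  · have hk : l ≠ F.k₀ := fun h => F.hjk (hj.symm.trans h)
    simp only [if_pos hj, if_neg hk, add_zero]; exact key 0
  · by_cases hk : l = F.k₀
    · simp only [if_neg hj, if_pos hk, zero_add]; exact key 1
    · simp [hj, hk]

/-- **`|Δ_l(t)| ≤ 2`.** [folklore] -/
theorem abs_Δ_le_two (ω : F.Rnd) (l : Fin d) (t : ℕ) : |F.Δ ω l t| ≤ 2 := by
  have h1 := F.abs_drift_succ_sub_le l t
  have h2 := F.abs_rand_tau_succ_sub_le ω l t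
  have e : F.Δ ω l t = (F.drift l (t + 1) - F.drift l t) +
      (F.rand ω l (F.tau (t + 1)) - F.rand ω l (F.tau t)) := by unfold Δ cpos; ring
  rw [e]
  exact (abs_add_le _ _).trans (by linarith)

/-- `|Δ_l(t)| ≤ 1` off the random axes. [folklore] -/
theorem abs_Δ_le_one (ω : F.Rnd) {l : Fin d} (hj : l ≠ F.j₀) (hk : l ≠ F.k₀) (t : ℕ) :
    |F.Δ ω l t| ≤ 1 := by
  have h1 := F.abs_drift_succ_sub_le l t
  have e : F.Δ ω l t = F.drift l (t + 1) - F.drift l t := by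
    unfold Δ cpos; rw [F.rand_of_ne ω hj hk, F.rand_of_ne ω hj hk]; ring
  rwa [e]

/-! ### Phases, block trails, the vertex list -/

/-- The axes other than `i₀`, in increasing order. [folklore] -/
def others : List (Fin d) := (List.finRange d).filter (· ≠ F.i₀)

/-- Membership in `others`. [folklore] -/
@[simp] theorem mem_others {l : Fin d} : l ∈ F.others ↔ l ≠ F.i₀ := by simp [others]

/-- `others` has no duplicates. [folklore] -/
theorem nodup_others : F.others.Nodup := (List.nodup_finRange d).filter _

/-- The phase list of block `t`: the time step `(i₀, σ)` first, then `(l, Δ_l(t))` for the other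
axes. [folklore] -/
def blockPh (ω : F.Rnd) (t : ℕ) : List (Fin d × ℤ) :=
  (F.i₀, F.σ) :: F.others.map fun l => (l, F.Δ ω l t)

/-- The axes of a block's phases are pairwise distinct. [folklore] -/
theorem nodup_axes_blockPh (ω : F.Rnd) (t : ℕ) : ((F.blockPh ω t).map Prod.fst).Nodup := by
  unfold blockPh
  simp only [List.map_cons, List.map_map, List.nodup_cons, List.mem_map, Function.comp_apply,
    mem_others, not_exists, not_and]
  refine ⟨fun l hl h => hl h, ?_⟩
  have : (Prod.fst ∘ fun l => (l, F.Δ ω l t)) = id := by funext l; rfl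
  rw [this, List.map_id]
  exact F.nodup_others

/-- A coordinate of the displacement of a list of phases indexed by distinct axes. [folklore] -/
theorem disp_map_apply {L : List (Fin d)} (hL : L.Nodup) (f : Fin d → ℤ) (l : Fin d) :
    disp (L.map fun l' => (l', f l')) l = if l ∈ L then f l else 0 := by
  classical
  induction L with
  | nil => simp
  | cons a rest ih =>
    rw [List.nodup_cons] at hL
    rw [List.map_cons, disp_cons, Pi.add_apply, ih hL.2]
    by_cases h : l = a
    · subst h; simp [hL.1]
    · simp [h]

/-- **The displacement of a block is `P(t+1) − P(t)`.** [folklore] -/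
theorem disp_blockPh (ω : F.Rnd) (t : ℕ) : disp (F.blockPh ω t) = F.P ω (t + 1) - F.P ω t := by
  funext l
  rw [blockPh, disp_cons, Pi.add_apply, disp_map_apply F.nodup_others, Pi.sub_apply]
  by_cases h : l = F.i₀
  · subst h
    simp only [Pi.single_eq_same, mem_others, ne_eq, not_true_eq_false, if_false, add_zero]
    rw [← F.Δ_i₀ ω t]; rfl
  · simp only [Pi.single_apply, h, if_false, mem_others, ne_eq, not_false_eq_true, if_true, zero_add]
    rfl

/-- The trail of block `t`. [folklore] -/
def blockTrail (ω : F.Rnd) (t : ℕ) : List (Site d) := trail (F.P ω t) (F.blockPh ω t)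

/-- The phases of the first `n` blocks. [folklore] -/
def allPh (ω : F.Rnd) (n : ℕ) : List (Fin d × ℤ) := (List.range n).flatMap (F.blockPh ω)

/-- **The vertex list of the path**: `x` followed by the trail of all `T` blocks. [folklore] -/
def verts (ω : F.Rnd) : List (Site d) := F.x :: trail F.x (F.allPh ω F.T)

/-- The displacement of the first `n` blocks. [folklore] -/
theorem x_add_disp_allPh (ω : F.Rnd) (n : ℕ) : F.x + disp (F.allPh ω n) = F.P ω n := by
  induction n with
  | zero => simp [allPh]
  | succ n ih =>
    rw [allPh, List.range_succ, List.flatMap_append, disp_append, ← add_assoc, ← allPh, ih,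
      List.flatMap_singleton, disp_blockPh, add_sub_cancel]

/-- The trail of the first `n + 1` blocks. [folklore] -/
theorem trail_allPh_succ (ω : F.Rnd) (n : ℕ) :
    trail F.x (F.allPh ω (n + 1)) = trail F.x (F.allPh ω n) ++ F.blockTrail ω n := by
  rw [allPh, List.range_succ, List.flatMap_append, trail_append, ← allPh, x_add_disp_allPh,
    List.flatMap_singleton]
  rfl

/-- **Block decomposition of the trail.** [folklore] -/
theorem trail_allPh_eq_flatMap (ω : F.Rnd) (n : ℕ) :
    trail F.x (F.allPh ω n) = (List.range n).flatMap (F.blockTrail ω) := by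
  induction n with
  | zero => simp [allPh]
  | succ n ih => rw [trail_allPh_succ, ih, List.range_succ, List.flatMap_append, List.flatMap_singleton]

/-- **The path ends at `y`.** [folklore] -/
theorem getLast_verts (ω : F.Rnd) : (F.verts ω).getLast (List.cons_ne_nil _ _) = F.y := by
  unfold verts
  rw [getLast_cons_trail, x_add_disp_allPh, P_T]

/-- **Consecutive vertices are lattice neighbours.** [folklore] -/
theorem isChain_verts (ω : F.Rnd) : List.IsChain (zdGraph d).Adj (F.verts ω) :=
  isChain_cons_trail _ _

/-- **The level of a block**: every vertex of the trail of block `t` has time coordinate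
`x_{i₀} + σ (t+1)`. [folklore] -/
theorem apply_i₀_of_mem_blockTrail (ω : F.Rnd) {t : ℕ} {w : Site d} (hw : w ∈ F.blockTrail ω t) :
    w F.i₀ = F.x F.i₀ + F.σ * (t + 1) := by
  rw [blockTrail, blockPh, trail_cons, List.mem_append] at hw
  have hP : F.P ω t F.i₀ = F.x F.i₀ + F.σ * t := F.cpos_i₀ ω t
  rcases hw with hw | hw
  · rw [seg, mem_segN] at hw
    obtain ⟨j, hj1, hjn, rfl⟩ := hw
    have hn : F.σ.natAbs = 1 := by rcases F.σ_eq_or with h | h <;> simp [h]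
    rw [hn] at hjn
    have : j = 1 := by omega
    subst this
    have hs : F.σ.sign = F.σ := by rcases F.σ_eq_or with h | h <;> simp [h]
    simp only [Pi.add_apply, Pi.single_eq_same, hP, hs]; push_cast; ring
  · have hnot : F.i₀ ∉ (F.others.map fun l => (l, F.Δ ω l t)).map Prod.fst := by
      simp [others]
    rw [apply_eq_of_mem_trail hw hnot]
    simp only [Pi.add_apply, Pi.single_eq_same, hP]; ring

/-- **The vertices are pairwise distinct.** [folklore] -/
theorem nodup_verts (ω : F.Rnd) : (F.verts ω).Nodup := by
  unfold verts
  rw [trail_allPh_eq_flatMap, List.nodup_cons]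
  have hσ := F.σ_ne_zero
  constructor
  · simp only [List.mem_flatMap, List.mem_range, not_exists, not_and]
    intro t _ hx
    have := F.apply_i₀_of_mem_blockTrail ω hx
    have : F.σ * (t + 1) = 0 := by linarith
    rcases mul_eq_zero.1 this with h | h
    · exact hσ h
    · omega
  · rw [List.nodup_flatMap]
    constructor
    · intro t _
      exact (List.nodup_cons.1 (nodup_cons_trail (F.nodup_axes_blockPh ω t))).2
    · refine List.Pairwise.imp (fun {t t'} htt' => ?_) List.pairwise_lt_range
      rw [Function.onFun, List.disjoint_left]
      intro w hw hw'
      have h1 := F.apply_i₀_of_mem_blockTrail ω hw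
      have h2 := F.apply_i₀_of_mem_blockTrail ω hw'
      have : F.σ * (t + 1) = F.σ * (t' + 1) := by linarith
      have := mul_left_cancel₀ hσ this
      omega

/-! ### The ball -/

/-- Coordinates of block-trail vertices lie between the block's end points. [folklore] -/
theorem apply_mem_uIcc_of_mem_blockTrail (ω : F.Rnd) {t : ℕ} {w : Site d} (hw : w ∈ F.blockTrail ω t)
    (l : Fin d) : w l ∈ Set.uIcc (F.cpos ω l t) (F.cpos ω l (t + 1)) := by
  have h := apply_mem_uIcc_of_mem_trail (F.nodup_axes_blockPh ω t) hw l
  rw [disp_blockPh] at h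
  simpa [P] using h

/-- The skeleton stays within `|v_l|/2 + [l ∈ {j₀,k₀}] T/2` of the midpoint (`t ≤ T`). [folklore] -/
theorem abs_cpos_sub_mid_le (ω : F.Rnd) (l : Fin d) {t : ℕ} (ht : t ≤ F.T) :
    |(F.cpos ω l t : ℝ) - ((F.x l : ℝ) + F.y l) / 2| ≤
      |(F.v l : ℝ)| / 2 + (if l = F.j₀ then (F.T : ℝ) / 2 else 0) + (if l = F.k₀ then (F.T : ℝ) / 2 else 0) := by
  have hd := F.drift_mem_uIcc l ht
  have hr0 : (0 : ℝ) ≤ F.rand ω l (F.tau t) := by exact_mod_cast F.rand_nonneg ω l _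
  have hr1 : (F.rand ω l (F.tau t) : ℝ) ≤ F.T / 2 :=
    (F.rand_le ω l _).trans (by gcongr; exact_mod_cast F.tau_le t)
  have hv : (F.y l : ℝ) = F.x l + F.v l := by simp [v]
  have e : (F.cpos ω l t : ℝ) - ((F.x l : ℝ) + F.y l) / 2 =
      ((F.drift l t : ℝ) - (F.v l : ℝ) / 2) + F.rand ω l (F.tau t) := by
    rw [hv]; unfold cpos; push_cast; ring
  rw [e]
  have hdr : |(F.drift l t : ℝ) - (F.v l : ℝ) / 2| ≤ |(F.v l : ℝ)| / 2 := by
    rcases le_total 0 (F.v l) with h0 | h0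
    · rw [Set.uIcc_of_le h0, Set.mem_Icc] at hd
      have h0' : (0 : ℝ) ≤ F.v l := by exact_mod_cast h0
      have hd1 : (0 : ℝ) ≤ F.drift l t := by exact_mod_cast hd.1
      have hd2 : (F.drift l t : ℝ) ≤ F.v l := by exact_mod_cast hd.2
      rw [abs_of_nonneg h0', abs_le]; constructor <;> linarith
    · rw [Set.uIcc_of_ge h0, Set.mem_Icc] at hd
      have h0' : (F.v l : ℝ) ≤ 0 := by exact_mod_cast h0
      have hd1 : (F.v l : ℝ) ≤ F.drift l t := by exact_mod_cast hd.1
      have hd2 : (F.drift l t : ℝ) ≤ 0 := by exact_mod_cast hd.2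
      rw [abs_of_nonpos h0', abs_le]; constructor <;> linarith
  rw [add_assoc]
  refine (abs_add_le _ _).trans (add_le_add hdr ?_)
  rw [abs_of_nonneg hr0]
  by_cases hj : l = F.j₀
  · have hk : l ≠ F.k₀ := fun h => F.hjk (hj.symm.trans h)
    rw [if_pos hj, if_neg hk, add_zero]; exact hr1
  · by_cases hk : l = F.k₀
    · rw [if_neg hj, if_pos hk, zero_add]; exact hr1
    · rw [F.rand_of_ne ω hj hk, if_neg hj, if_neg hk]; simp

/-- `T² ≤ ‖v‖₂²`. [folklore] -/
theorem T_sq_le : ((F.T : ℝ)) ^ 2 ≤ ∑ i, ((F.x i : ℝ) - F.y i) ^ 2 := by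
  have e : ∀ i, ((F.x i : ℝ) - F.y i) ^ 2 = ((F.v i : ℝ)) ^ 2 := fun i => by simp [v]; ring
  simp_rw [e]
  have hT : ((F.T : ℝ)) ^ 2 = ((F.v F.i₀ : ℝ)) ^ 2 := by
    rw [show (F.T : ℝ) = |(F.v F.i₀ : ℝ)| by rw [← Int.cast_abs]; exact_mod_cast F.T_eq_abs, sq_abs]
  rw [hT]
  exact Finset.single_le_sum (f := fun i => ((F.v i : ℝ)) ^ 2) (fun i _ => sq_nonneg _) (Finset.mem_univ _)

/-- **Every vertex of the path lies in the closed ball `B((x+y)/2, 2‖x−y‖₂)`** (squared form).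
[cite: GarbanSpencer2022, proof of Theorem 1.3, Step 2 (the ball condition)] -/
theorem mem_ball_of_mem_verts (ω : F.Rnd) {w : Site d} (hw : w ∈ F.verts ω) :
    ∑ i, ((w i : ℝ) - ((F.x i : ℝ) + (F.y i : ℝ)) / 2) ^ 2 ≤ 4 * ∑ i, ((F.x i : ℝ) - (F.y i : ℝ)) ^ 2 := by
  have hv2 : ∀ i, ((F.x i : ℝ) - F.y i) ^ 2 = ((F.v i : ℝ)) ^ 2 := fun i => by simp [v]; ring
  unfold verts at hw
  rw [trail_allPh_eq_flatMap, List.mem_cons, List.mem_flatMap] at hw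
  rcases hw with rfl | ⟨t, ht, hw⟩
  · have : ∀ i, ((F.x i : ℝ) - ((F.x i : ℝ) + (F.y i : ℝ)) / 2) ^ 2 = ((F.x i : ℝ) - F.y i) ^ 2 / 4 :=
      fun i => by ring
    simp_rw [this, ← Finset.sum_div]
    have h0 : 0 ≤ ∑ i, ((F.x i : ℝ) - F.y i) ^ 2 := Finset.sum_nonneg fun i _ => sq_nonneg _
    linarith
  · rw [List.mem_range] at ht
    -- per-coordinate bound
    have hcoord : ∀ l, ((w l : ℝ) - ((F.x l : ℝ) + (F.y l : ℝ)) / 2) ^ 2 ≤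
        ((F.v l : ℝ)) ^ 2 / 2 + (if l = F.j₀ then (F.T : ℝ) ^ 2 else 0) + (if l = F.k₀ then (F.T : ℝ) ^ 2 else 0) := by
      intro l
      have hu := F.apply_mem_uIcc_of_mem_blockTrail ω hw l
      have b0 := F.abs_cpos_sub_mid_le ω l ht.le
      have b1 := F.abs_cpos_sub_mid_le ω l (Nat.succ_le_of_lt ht)
      set m : ℝ := ((F.x l : ℝ) + (F.y l : ℝ)) / 2
      set B : ℝ := |(F.v l : ℝ)| / 2 + (if l = F.j₀ then (F.T : ℝ) / 2 else 0) + (if l = F.k₀ then (F.T : ℝ) / 2 else 0)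
      have hwB : |(w l : ℝ) - m| ≤ B := by
        rcases Set.mem_uIcc.1 hu with ⟨h1, h2⟩ | ⟨h1, h2⟩
        · have h1' : (F.cpos ω l t : ℝ) ≤ w l := by exact_mod_cast h1
          have h2' : (w l : ℝ) ≤ F.cpos ω l (t + 1) := by exact_mod_cast h2
          rw [abs_le] at b0 b1 ⊢; constructor <;> linarith [b0.1, b1.2]
        · have h1' : (F.cpos ω l (t + 1) : ℝ) ≤ w l := by exact_mod_cast h1
          have h2' : (w l : ℝ) ≤ F.cpos ω l t := by exact_mod_cast h2
          rw [abs_le] at b0 b1 ⊢; constructor <;> linarith [b1.1, b0.2]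
      have hsq : ((w l : ℝ) - m) ^ 2 ≤ B ^ 2 := by
        rw [← sq_abs]; exact pow_le_pow_left₀ (abs_nonneg _) hwB 2
      refine hsq.trans ?_
      have hT0 : (0 : ℝ) ≤ F.T := Nat.cast_nonneg _
      have hva := sq_abs (F.v l : ℝ)
      have hva0 := abs_nonneg (F.v l : ℝ)
      by_cases hj : l = F.j₀
      · have hk : ¬ l = F.k₀ := fun h => F.hjk (hj.symm.trans h)
        simp only [B, if_pos hj, if_neg hk, add_zero]
        nlinarith
      · by_cases hk : l = F.k₀
        · simp only [B, if_neg hj, if_pos hk, add_zero]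
          nlinarith
        · simp only [B, if_neg hj, if_neg hk, add_zero]
          nlinarith
    calc ∑ i, ((w i : ℝ) - ((F.x i : ℝ) + (F.y i : ℝ)) / 2) ^ 2
        ≤ ∑ i, (((F.v i : ℝ)) ^ 2 / 2 + (if i = F.j₀ then (F.T : ℝ) ^ 2 else 0) +
            (if i = F.k₀ then (F.T : ℝ) ^ 2 else 0)) := Finset.sum_le_sum fun i _ => hcoord i
      _ = (∑ i, ((F.v i : ℝ)) ^ 2) / 2 + (F.T : ℝ) ^ 2 + (F.T : ℝ) ^ 2 := by
          rw [Finset.sum_add_distrib, Finset.sum_add_distrib, Finset.sum_ite_eq', Finset.sum_ite_eq',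
            Finset.sum_div]
          simp
      _ ≤ 4 * ∑ i, ((F.x i : ℝ) - (F.y i : ℝ)) ^ 2 := by
          have hT := F.T_sq_le
          simp_rw [hv2] at hT ⊢
          have h0 : 0 ≤ ∑ i, ((F.v i : ℝ)) ^ 2 := Finset.sum_nonneg fun i _ => sq_nonneg _
          linarith

end Frame

end BallPath

end Literature.Probability.LatticeModels
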